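import Literature.NumberTheory.EllipticCurves.ShaRestrictionJZeroInvariants
import Literature.NumberTheory.EllipticCurves.ConjH1PointsLiftIndependence
import HarnessLib

/-!
# Corestriction `H¹(K, E_K) → H¹(ℚ, E)` along a QUADRATIC field `K/ℚ` on the tree's `galH1`,
# with `cor ∘ res = 2` and `res ∘ cor = 1 + σ_*` (and the model map `H¹(Γ_K, E_K(K̄)) ≅ H¹(galRange K, E(ℚ̄))`)

Topic `NumberTheory/EllipticCurves`, family `bsd`. Vocabulary: `Sha.lean` / `ShaRestriction.lean` (the tree's
`W.galH1 = H¹_cont(Γ_ℚ, E(ℚ̄))`, `(W.baseChange K).galH1`, `resBaseChange W K`, `shaRestriction W K`, `pointsMap`,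
`localPointsEquivGeomPoints`), `SelmerPInftyRestriction.lean` (the index-`[K:ℚ]` open subgroup `galRange K ≤ Γ_ℚ`,
`resGalToRange` / `rangeToResGal`, `liftToAbsGal K σ₀`, `isOpen_galRange`, `normal_galRange`, `xor_galRange`),
`SelmerPInftyGaloisAction.lean` (`IsLiftOfAut.conjH1Points` = the action `σ_*` of a lift of `σ ∈ Aut(K/ℚ)` on
`H¹(K, E_K)`), `ConjH1PointsLiftIndependence.lean` (`IsLiftOfAut.conjH1Points_eq`), and the ABSTRACT index-`2`
transfer of `H1CorestrictionIndexTwo.lean` (`corH1`, `resSubgroupH1_corH1 : res ∘ cor = 1 + c_*`,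
`corH1_resSubgroupH1 : cor ∘ res = 2` on `subgroupH1 N M` / `discreteH1 G M`).  DEFINITIONS + THEOREMS (no named
fact, no instance, no notation, no `sorry`; D-0026 debt 0).  Seat `bsd-cm-k-ty1` (tenth seating), planner GO D568
(α2) file A; helper of crux `stmt-BirchSwinnertonDyer-19804` (`UpperOffV0HSYPlus`, rows k-p2: the projection-formula
input (CT-3) of the TAIL's Lagrangian step).  No summit statement is proved or advanced by this file alone; BSD is
not claimed.

## WHAT AND WHY

The model isomorphism `Φ : H¹(Γ_K, E_K(K̄)) → H¹(galRange K, E(ℚ̄))` of the compatible pair `(rangeToResGal, θ⁻¹)`,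
`θ : E(ℚ̄) ≃ E_K(K̄)` the chosen embedding on coordinates, was so far built only INSIDE the proof of
`JZero.exists_resBaseChange_eq_of_conjH1Points_eq` (`ShaRestrictionJZeroInvariants.lean`; SPEC-K-TY §1 (I4) «MISSING
DECL modelIsoPoints»).  §1 makes it a DECL (`geomPointsEquivBaseChange`, `galH1Model`, `galH1ModelInv`, both round
trips, `Φ ∘ resBaseChange = resSubgroupH1`, `Φ ∘ τ_* = c_* ∘ Φ`).  §2 defines the CORESTRICTION
`corBaseChange W K σ₀ h2 hσ₀ : (W.baseChange K).galH1 →+ W.galH1 := corH1 ∘ Φ` for `[K : ℚ] = 2`, `σ₀ ≠ 1`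
(`c = liftToAbsGal K σ₀`; the `Normal`/`IsGalois` instances are supplied INSIDE the definition from `h2`, no
top-level instance) and PROVES `cor ∘ res = 2` (`corBaseChange_resBaseChange`) and `res ∘ cor = 1 + σ_*` for EVERY
lift of `σ₀` (`resBaseChange_corBaseChange`), plus the `Ш`-level reading `cor (res a) = 2 • a`.  Consumer: file B
`CasselsTateResCorAdjoint.lean` (planner D568 (α2)): Fisher 2003 Prop. 2.16 («restriction and corestriction are
adjoints with respect to the Cassels–Tate pairing») as a named fact over THIS `cor`, and its two `j = 0`
consequences `B_K(res a, res b) = 2·B_ℚ(a, b)`, `B_K(res a, w·res b) = −B_ℚ(a, b)` for the TAIL of crux 19804.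

NOT HERE (by design): «`cor` maps `Ш(E_K/K)` into `Ш(E/ℚ)`» for a GENERAL `E` (the local double-coset
compatibility of `cor` with the tree's completion-based local conditions is not in the tree; for `j = 0` short
models over `K ∋ ζ₃` it follows from `res (cor c) = c + σ_* c` and `JZero.mem_sha_of_resBaseChange_mem_sha`); a
corestriction for `[K : ℚ] > 2` (the tree's transfer is the index-`2` formula).

## THE PRINT

J.-P. Serre, *Galois Cohomology*, I.§2.4 (Res, Cor for an open subgroup of finite index; Prop. 9:
`Cor ∘ Res = (G : H)`), I.§5.8 (compatible pairs, conjugation); Neukirch–Schmidt–Wingberg, *Cohomology of Number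
Fields*, I.§5 (Cor on cochains, `Res ∘ Cor` = double-coset sum = `1 + c_*` for a normal subgroup of index 2);
T. A. Fisher, J. Number Theory 98 (2003), proof of Prop. 2.16 («corestriction is the map on cohomology
corresponding to the norm in dimension 0») [corpus: paper:doi-10-1016-s0022-314x-02-00038-0 p28 L12–18].

## WHAT IS FORMALISED (`K : Type` a number field, `W : WeierstrassCurve ℚ`; §2 also `σ₀ : K ≃ₐ[ℚ] K`,
## `h2 : Module.finrank ℚ K = 2`, `hσ₀ : σ₀ ≠ 1`)

* §1 `geomPointsEquivBaseChange K W : geomPoints W ≃+ geomPoints (W.baseChange K)` (+ `_apply`, `_smul`,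
  `_symm_smul`, `_smul'`, `_conj`); `galH1Model K W` (Φ), `galH1ModelInv K W` (Ψ), `galH1ModelInv_galH1Model`,
  `galH1Model_galH1ModelInv`, `galH1Model_injective`, ★ `galH1Model_resBaseChange`
  (`Φ (resBaseChange W K η) = resSubgroupH1 (galRange K) (geomPoints W) η`), ★ `galH1Model_conjH1Points`
  (`[IsGalois ℚ K]`, `h2`, `hσ`: `Φ (τ_* x) = conjH1 … (liftToAbsGal K σ) (Φ x)`).
* §2 ★ `corBaseChange K W σ₀ h2 hσ₀ : (W.baseChange K).galH1 →+ W.galH1`; ★ `corBaseChange_resBaseChange (a) :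
  cor (resBaseChange W K a) = 2 • a`; ★ `resBaseChange_corBaseChange (hτ : IsLiftOfAut σ₀ τ) (c) :
  resBaseChange W K (cor c) = c + hτ.conjH1Points W c`; `corBaseChange_shaRestriction`,
  `corBaseChange_shaRestriction_mem` (`Ш`-level `cor (res a) = 2 • a ∈ Ш(E/ℚ)`).

## References

* J.-P. Serre, *Galois Cohomology*, Springer 1997, I.§2.4 Prop. 9, I.§5.8. [SerreGaloisCohomology1997]
* J. Neukirch, A. Schmidt, K. Wingberg, *Cohomology of Number Fields*, 2nd ed. 2008, I.§5. [NeukirchSchmidtWingberg2008]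
* T. A. Fisher, *The Cassels–Tate pairing and the Platonic solids*, J. Number Theory 98 (2003) 105–155, Prop. 2.16.
  [Fisher2003]
* Tree: `H1CorestrictionIndexTwo.lean`, `ShaRestrictionJZeroInvariants.lean` (proof of
  `JZero.exists_resBaseChange_eq_of_conjH1Points_eq`, l.100–190, now §1), `ConjH1PointsLiftIndependence.lean`.
-/

set_option autoImplicit false

noncomputable section

open scoped Classical

namespace Literature.NumberTheory.EllipticCurves

open GaloisRepresentations WeierstrassCurve

section Model

variable (K : Type) [Field K] [NumberField K] (W : WeierstrassCurve ℚ)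

/-- The Galois action of `Γ_ℚ` on `E(ℚ̄)` has open stabilisers, hence continuous orbit maps
(`isOpen_stabilizer_point_holds`). [folklore] -/
private theorem continuous_smul_geomPoints (P : geomPoints W) :
    Continuous fun g : Field.absoluteGaloisGroup ℚ ↦ g • P :=
  continuous_smul_of_isOpen_stabilizer P (isOpen_stabilizer_point_holds W P)

/-- **The coefficient isomorphism `θ : E(ℚ̄) ≃ E_K(K̄)`** (the chosen embedding `ℚ̄ → K̄` on
coordinates: `pointsMap` followed by `localPointsEquivGeomPoints`). Serre, *Galois Cohomology*,
I.§2.4 (compatible pairs). [cite: SerreGaloisCohomology1997, I.§2.4] -/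
def geomPointsEquivBaseChange : geomPoints W ≃+ geomPoints (W.baseChange K) :=
  AddEquiv.ofBijective ((localPointsEquivGeomPoints W K).toAddMonoidHom.comp (pointsMap W K))
    ((localPointsEquivGeomPoints W K).bijective.comp
      (pointsMapOfEmb_bijective K W (closureEmb (K := ℚ) K)))

/-- Unfolding `geomPointsEquivBaseChange`. [cite: SerreGaloisCohomology1997, I.§2.4 (compatible pairs)] -/
theorem geomPointsEquivBaseChange_apply (P : geomPoints W) :
    geomPointsEquivBaseChange K W P = localPointsEquivGeomPoints W K (pointsMap W K P) :=
  rfl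

/-- `θ` is equivariant along the restriction `resGal : Γ_K → Γ_ℚ`: `θ (g|_ℚ̄ • P) = g • θ P`.
[cite: SerreGaloisCohomology1997, I.§2.4 (compatible pairs)] -/
theorem geomPointsEquivBaseChange_smul (g : Field.absoluteGaloisGroup K) (P : geomPoints W) :
    geomPointsEquivBaseChange K W (resGal (K := ℚ) K g • P) = g • geomPointsEquivBaseChange K W P := by
  rw [geomPointsEquivBaseChange_apply, geomPointsEquivBaseChange_apply, pointsMap_smul,
    localPointsEquivGeomPoints_smul]

/-- `θ⁻¹` is equivariant along `rangeToResGal : galRange K → Γ_K`. [cite: SerreGaloisCohomology1997, I.§2.4 (compatible pairs)] -/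
theorem geomPointsEquivBaseChange_symm_smul (n : galRange (K := ℚ) K)
    (Q : geomPoints (W.baseChange K)) :
    (geomPointsEquivBaseChange K W).symm (rangeToResGal (K := ℚ) K n • Q) =
      n • (geomPointsEquivBaseChange K W).symm Q := by
  apply (geomPointsEquivBaseChange K W).injective
  rw [AddEquiv.apply_symm_apply]
  have e : geomPointsEquivBaseChange K W (n • (geomPointsEquivBaseChange K W).symm Q) =
      geomPointsEquivBaseChange K W (resGal (K := ℚ) K (rangeToResGal (K := ℚ) K n) •
        (geomPointsEquivBaseChange K W).symm Q) := by
    rw [resGal_rangeToResGal]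
    rfl
  rw [e, geomPointsEquivBaseChange_smul, AddEquiv.apply_symm_apply]

/-- `θ` is equivariant along `resGalToRange : Γ_K → galRange K`. [cite: SerreGaloisCohomology1997, I.§2.4 (compatible pairs)] -/
theorem geomPointsEquivBaseChange_smul' (g : Field.absoluteGaloisGroup K) (P : geomPoints W) :
    geomPointsEquivBaseChange K W (resGalToRange (K := ℚ) K g • P) =
      g • geomPointsEquivBaseChange K W P :=
  geomPointsEquivBaseChange_smul K W g P

/-- `θ` intertwines the chosen lift `liftToAbsGal K σ ∈ Γ_ℚ` of `σ ∈ Aut(K/ℚ)` with the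
semilinear points map of the lift `liftAut σ` of `σ` to `K̄`. [cite: SerreGaloisCohomology1997, I.§2.4 (compatible pairs)] -/
theorem geomPointsEquivBaseChange_conj (σ : K ≃ₐ[ℚ] K) (Q : geomPoints W) :
    geomPointsEquivBaseChange K W (liftToAbsGal (K := ℚ) K σ • Q) =
      (isLiftOfAut_liftAut σ).pointsMap W (geomPointsEquivBaseChange K W Q) := by
  rw [geomPointsEquivBaseChange_apply, geomPointsEquivBaseChange_apply]
  exact localPointsEquivGeomPoints_pointsMap_smul W σ Q

/-- **The model map `Φ : H¹(Γ_K, E_K(K̄)) → H¹(galRange K, E(ℚ̄))`** of the compatible pair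
`(rangeToResGal, θ⁻¹)` (Serre, *Galois Cohomology*, I.§2.4): the tree's `(W.baseChange K).galH1`
read on the index-`[K:ℚ]` open subgroup `galRange K ≤ Γ_ℚ`. [cite: SerreGaloisCohomology1997, I.§2.4] -/
def galH1Model : (W.baseChange K).galH1 →+ subgroupH1 (galRange (K := ℚ) K) (geomPoints W) :=
  resH1Hom (rangeToResGal (K := ℚ) K) (geomPointsEquivBaseChange K W).symm.toAddMonoidHom
    (geomPointsEquivBaseChange_symm_smul K W)

/-- The inverse model map `Ψ : H¹(galRange K, E(ℚ̄)) → H¹(Γ_K, E_K(K̄))` of the pair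
`(resGalToRange, θ)`. [cite: SerreGaloisCohomology1997, I.§2.4] -/
def galH1ModelInv : subgroupH1 (galRange (K := ℚ) K) (geomPoints W) →+ (W.baseChange K).galH1 :=
  resH1Hom (resGalToRange (K := ℚ) K) (geomPointsEquivBaseChange K W).toAddMonoidHom
    (geomPointsEquivBaseChange_smul' K W)

/-- `Ψ ∘ Φ = id`. [cite: SerreGaloisCohomology1997, I.§2.4 (compatible pairs)] -/
theorem galH1ModelInv_galH1Model (x : (W.baseChange K).galH1) :
    galH1ModelInv K W (galH1Model K W x) = x := by
  rw [galH1Model, galH1ModelInv, resH1Hom_resH1Hom]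
  have e : resH1Hom ((rangeToResGal (K := ℚ) K).comp (resGalToRange (K := ℚ) K))
      ((geomPointsEquivBaseChange K W).toAddMonoidHom.comp
        (geomPointsEquivBaseChange K W).symm.toAddMonoidHom)
      (fun x m ↦ by
        simp only [AddMonoidHom.coe_comp, Function.comp_apply, ContinuousMonoidHom.comp_toFun,
          AddEquiv.coe_toAddMonoidHom, geomPointsEquivBaseChange_symm_smul,
          geomPointsEquivBaseChange_smul']) =
        resH1Hom (ContinuousMonoidHom.id _) (AddMonoidHom.id _) (fun _ _ ↦ rfl) :=
    resH1Hom_congr (by ext g; exact rangeToResGal_resGalToRange K g)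
      (by ext Q; exact (geomPointsEquivBaseChange K W).apply_symm_apply Q) _ _
  rw [e, resH1Hom_id]
  rfl

/-- `Φ ∘ Ψ = id`. [cite: SerreGaloisCohomology1997, I.§2.4 (compatible pairs)] -/
theorem galH1Model_galH1ModelInv (y : subgroupH1 (galRange (K := ℚ) K) (geomPoints W)) :
    galH1Model K W (galH1ModelInv K W y) = y := by
  rw [galH1Model, galH1ModelInv, resH1Hom_resH1Hom]
  have e : resH1Hom ((resGalToRange (K := ℚ) K).comp (rangeToResGal (K := ℚ) K))
      ((geomPointsEquivBaseChange K W).symm.toAddMonoidHom.comp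
        (geomPointsEquivBaseChange K W).toAddMonoidHom)
      (fun x m ↦ by
        simp only [AddMonoidHom.coe_comp, Function.comp_apply, ContinuousMonoidHom.comp_toFun,
          AddEquiv.coe_toAddMonoidHom, geomPointsEquivBaseChange_symm_smul,
          geomPointsEquivBaseChange_smul']) =
        resH1Hom (ContinuousMonoidHom.id _) (AddMonoidHom.id _) (fun _ _ ↦ rfl) :=
    resH1Hom_congr (by ext n; exact congrArg Subtype.val (resGalToRange_rangeToResGal K n))
      (by ext Q; exact (geomPointsEquivBaseChange K W).symm_apply_apply Q) _ _
  rw [e, resH1Hom_id]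
  rfl

/-- `Φ` is injective. [cite: SerreGaloisCohomology1997, I.§2.4 (compatible pairs)] -/
theorem galH1Model_injective : Function.Injective (galH1Model K W) := fun x y h ↦ by
  rw [← galH1ModelInv_galH1Model K W x, ← galH1ModelInv_galH1Model K W y, h]

/-- **`Φ ∘ res = res`**: under the model map the tree's `resBaseChange W K`
(`H¹(ℚ, E) → H¹(K, E_K)`) becomes the subgroup restriction `resSubgroupH1 (galRange K)`.
[cite: SerreGaloisCohomology1997, I.§2.4] -/
theorem galH1Model_resBaseChange (η : W.galH1) :
    galH1Model K W (resBaseChange W K η) = resSubgroupH1 (galRange (K := ℚ) K) (geomPoints W) η := by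
  rw [galH1Model]
  change resH1Hom (rangeToResGal (K := ℚ) K) (geomPointsEquivBaseChange K W).symm.toAddMonoidHom
    (geomPointsEquivBaseChange_symm_smul K W)
    (h1Equiv (localPointsEquivGeomPoints W K) (localPointsEquivGeomPoints_smul W K)
      (resH1Hom (resGal (K := ℚ) K) (pointsMap W K) (pointsMap_smul W K) η)) = _
  rw [h1Equiv_apply, resH1Hom_resH1Hom, resH1Hom_resH1Hom]
  have hG : ((resGal (K := ℚ) K).comp (ContinuousMonoidHom.id _)).comp
      (rangeToResGal (K := ℚ) K) = subgroupIncl (galRange (K := ℚ) K) := by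
    apply ContinuousMonoidHom.ext
    intro n
    exact resGal_rangeToResGal K n
  have hM : ((geomPointsEquivBaseChange K W).symm.toAddMonoidHom.comp
      ((localPointsEquivGeomPoints W K : localPoints W K →+ geomPoints (W.baseChange K)).comp
        (pointsMap W K))) = AddMonoidHom.id (geomPoints W) := by
    refine AddMonoidHom.ext fun P ↦ ?_
    apply (geomPointsEquivBaseChange K W).injective
    change geomPointsEquivBaseChange K W ((geomPointsEquivBaseChange K W).symm
      (localPointsEquivGeomPoints W K (pointsMap W K P))) = geomPointsEquivBaseChange K W P
    rw [AddEquiv.apply_symm_apply, geomPointsEquivBaseChange_apply]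
  exact congrFun (congrArg DFunLike.coe (resH1Hom_congr hG hM _ _)) η

/-- **`Φ ∘ τ_* = c_* ∘ Φ`**: under the model map the action `conjH1Points` of the lift `liftAut σ`
on `H¹(K, E_K)` becomes the conjugation `conjH1 (galRange K) _ (liftToAbsGal K σ)` (needs
`galRange K` normal: `[K : ℚ] = 2`, `σ ≠ 1`). [cite: SerreGaloisCohomology1997, I.§5.8] -/
theorem galH1Model_conjH1Points [IsGalois ℚ K] (h2 : Module.finrank ℚ K = 2) {σ : K ≃ₐ[ℚ] K}
    (hσ : σ ≠ 1) (x : (W.baseChange K).galH1) :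
    haveI : (galRange (K := ℚ) K).Normal := normal_galRange K h2 hσ
    galH1Model K W ((isLiftOfAut_liftAut σ).conjH1Points W x) =
      conjH1 (galRange (K := ℚ) K) (geomPoints W) (liftToAbsGal (K := ℚ) K σ) (galH1Model K W x) := by
  haveI : (galRange (K := ℚ) K).Normal := normal_galRange K h2 hσ
  have hG : ((isLiftOfAut_liftAut σ).conjGalCMH).comp (rangeToResGal (K := ℚ) K) =
      (rangeToResGal (K := ℚ) K).comp
        (subgroupConj (galRange (K := ℚ) K) (liftToAbsGal (K := ℚ) K σ)) := by
    apply ContinuousMonoidHom.ext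
    intro n
    apply resGal_injective (K := ℚ) K
    change resGal (K := ℚ) K ((isLiftOfAut_liftAut σ).conjGalCMH (rangeToResGal (K := ℚ) K n)) =
      resGal (K := ℚ) K (rangeToResGal (K := ℚ) K
        (subgroupConj (galRange (K := ℚ) K) (liftToAbsGal (K := ℚ) K σ) n))
    rw [resGal_conjGalCMH, resGal_rangeToResGal, resGal_rangeToResGal, subgroupConj_apply_coe]
  have hM : ((geomPointsEquivBaseChange K W).symm.toAddMonoidHom).comp
      ((isLiftOfAut_liftAut σ).pointsMap W) =
      (DistribSMul.toAddMonoidHom (geomPoints W) (liftToAbsGal (K := ℚ) K σ)).comp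
        (geomPointsEquivBaseChange K W).symm.toAddMonoidHom := by
    refine AddMonoidHom.ext fun m ↦ ?_
    apply (geomPointsEquivBaseChange K W).injective
    change geomPointsEquivBaseChange K W ((geomPointsEquivBaseChange K W).symm
        ((isLiftOfAut_liftAut σ).pointsMap W m)) =
      geomPointsEquivBaseChange K W (liftToAbsGal (K := ℚ) K σ • (geomPointsEquivBaseChange K W).symm m)
    rw [AddEquiv.apply_symm_apply, geomPointsEquivBaseChange_conj, AddEquiv.apply_symm_apply]
  rw [galH1Model, IsLiftOfAut.conjH1Points, conjH1, resH1Hom_resH1Hom, resH1Hom_resH1Hom]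
  exact congrFun (congrArg DFunLike.coe (resH1Hom_congr hG hM _ _)) x

end Model

/-! ## The corestriction -/

section Cor

variable (K : Type) [Field K] [NumberField K] (W : WeierstrassCurve ℚ)
  (σ₀ : K ≃ₐ[ℚ] K) (h2 : Module.finrank ℚ K = 2) (hσ₀ : σ₀ ≠ 1)

/-- **The corestriction `cor : H¹(K, E_K) → H¹(ℚ, E)`** for an elliptic curve `E = W/ℚ` and a
QUADRATIC field `K` (`[K : ℚ] = 2`, `σ₀ ≠ 1` its non-trivial automorphism), on the tree's
`galH1`: the index-`2` transfer `corH1` of `H1CorestrictionIndexTwo.lean` on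
`H¹(galRange K, E(ℚ̄))` (explicit formula `F(n) = f(n) + c • f(c⁻¹ n c)`,
`F(n c) = F(n) + n • f(c²)`, `c = liftToAbsGal K σ₀`) composed with the model map `Φ`.
Serre, *Galois Cohomology*, I.§2.4 (corestriction for an open subgroup of finite index);
Fisher 2003 §2 (proof of Prop. 2.16: «corestriction is the map on cohomology corresponding to
the norm in dimension 0»). [cite: SerreGaloisCohomology1997, I.§2.4]
[cite: Fisher2003, Prop. 2.16 (proof)] -/
def corBaseChange : (W.baseChange K).galH1 →+ W.galH1 :=
  haveI : Algebra.IsQuadraticExtension ℚ K := ⟨h2⟩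
  haveI : IsGalois ℚ K := inferInstance
  haveI : (galRange (K := ℚ) K).Normal := normal_galRange K h2 hσ₀
  (corH1 (isOpen_galRange (K := ℚ) K) (continuous_smul_geomPoints W) (xor_galRange K h2 hσ₀)).comp
    (galH1Model K W)

/-- **`cor ∘ res = 2 = [K : ℚ]`** on `H¹(ℚ, E)` (Serre, *Galois Cohomology*, I.§2.4, Prop. 9;
transport of `corH1_resSubgroupH1`). [cite: SerreGaloisCohomology1997, I.§2.4 Prop. 9] -/
theorem corBaseChange_resBaseChange (a : W.galH1) :
    corBaseChange K W σ₀ h2 hσ₀ (resBaseChange W K a) = 2 • a := by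
  haveI : Algebra.IsQuadraticExtension ℚ K := ⟨h2⟩
  haveI : IsGalois ℚ K := inferInstance
  haveI : (galRange (K := ℚ) K).Normal := normal_galRange K h2 hσ₀
  change corH1 (isOpen_galRange (K := ℚ) K) (continuous_smul_geomPoints W) (xor_galRange K h2 hσ₀)
    (galH1Model K W (resBaseChange W K a)) = 2 • a
  rw [galH1Model_resBaseChange, corH1_resSubgroupH1]

/-- **`res ∘ cor = 1 + σ_*`** on `H¹(K, E_K)`, with `σ_*` the action `IsLiftOfAut.conjH1Points` of
ANY lift `τ` of `σ₀` (transport of `resSubgroupH1_corH1`; lift-independence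
`IsLiftOfAut.conjH1Points_eq`). For a general subgroup of finite index this is the double-coset
formula. [cite: SerreGaloisCohomology1997, I.§2.4 Prop. 9 and I.§5.8] -/
theorem resBaseChange_corBaseChange {τ : AlgebraicClosure K ≃+* AlgebraicClosure K}
    (hτ : IsLiftOfAut σ₀ τ) (c : (W.baseChange K).galH1) :
    resBaseChange W K (corBaseChange K W σ₀ h2 hσ₀ c) = c + hτ.conjH1Points W c := by
  haveI : Algebra.IsQuadraticExtension ℚ K := ⟨h2⟩
  haveI : IsGalois ℚ K := inferInstance
  haveI : (galRange (K := ℚ) K).Normal := normal_galRange K h2 hσ₀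
  rw [IsLiftOfAut.conjH1Points_eq W hτ (isLiftOfAut_liftAut σ₀)]
  apply galH1Model_injective K W
  rw [galH1Model_resBaseChange, map_add, galH1Model_conjH1Points K W h2 hσ₀]
  change resSubgroupH1 (galRange (K := ℚ) K) (geomPoints W)
      (corH1 (isOpen_galRange (K := ℚ) K) (continuous_smul_geomPoints W) (xor_galRange K h2 hσ₀)
        (galH1Model K W c)) = _
  rw [resSubgroupH1_corH1]

/-- `cor (res a) = 2 • a` on `Ш(E/ℚ)` (coercions to `H¹`). [cite: SerreGaloisCohomology1997, I.§2.4 Prop. 9] -/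
theorem corBaseChange_shaRestriction (a : W.sha) :
    corBaseChange K W σ₀ h2 hσ₀ (shaRestriction W K a : (W.baseChange K).galH1) =
      ((2 • a : W.sha) : W.galH1) := by
  rw [coe_shaRestriction_apply, corBaseChange_resBaseChange, AddSubmonoidClass.coe_nsmul]

/-- In particular `cor (res a) ∈ Ш(E/ℚ)` for `a ∈ Ш(E/ℚ)`. [cite: SerreGaloisCohomology1997, I.§2.4 Prop. 9] -/
theorem corBaseChange_shaRestriction_mem (a : W.sha) :
    corBaseChange K W σ₀ h2 hσ₀ (shaRestriction W K a : (W.baseChange K).galH1) ∈ W.sha := by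
  rw [corBaseChange_shaRestriction]
  exact (2 • a).2

end Cor

end Literature.NumberTheory.EllipticCurves

end
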